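import Mathlib
import HarnessLib
import HarnessLib.Audit
import Summits.CriticalPhenomena.Statement
import Literature.Probability.RandomPlanarGeometry.ChordalCurveFamily
import HarnessLib.Audit.Status.Attr

/-!
Route: SAWTowerCount

# Route SAWTowerCount — kappa = 8/3 by counting — one state at level two of the Z^2 strip transfer
spectrum pins the corridor restriction exponent 5/8

It suffices to show X = X₀ ∧ (E) ∧ (L) [route realising idea card count-the-tower]. X₀
(CorridorMassFiveEighths, the target of
the spectral layer): the x_c-weighted end-to-end SAW partition functions Z_n(ℓ; i, j) of the width-n
strip of ℤ² (walks inside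
[0,ℓ]×[1,n] from (0,i) to (ℓ,j)) have, after a lattice normalisation A(n) regularly varying of index
5/4, the locally uniform
scaling limit A(n)·Z_n(⌊mn⌋; ⌊yn⌋, ⌊y′n⌋) → H_m(y,y′)^(5/8), where H_m(y,y′) = Σ_k k sin(kπy)
sin(kπy′)/sinh(kπm) is the Poisson
excursion kernel between the two ends of the rectangle (0,m)×(0,1) — LSW's covariance of the SAW
mass with exponent b = 5/8, in
corridors. X₀ is NOT filed as an assumption on 5/8: it is DERIVED (support SpectralPin, layer 1)
from (T) LevelTwoSolitude — the card's
count: above the scaled-gap line 9/4 the strip transfer spectrum coupled to end insertions is real,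
simple (rank-one coefficient
matrices) and has exactly ONE rate in the level-2 window (5/4, 9/4), i.e. the coefficients 1,1,1 of
(1−q²)/∏(1−qⁿ) up to level 2 —
and (C) CorridorCovariance with SOME exponent b > 0, via the provable KacRankPin: the q²-coefficient
kernel of H_m^b has rank one
iff b = 5/8 (its 2×2 determinant is 16b²(8b−5), the c = 0 level-2 Kac determinant read in a
corridor). (E) ExponentIdentifies: X₀
plus a full scaling limit P that is conformally covariant, has restriction, avoids the boundary and
does not retrace pins LSW's
exponent α = 5/8 and identifies P D as the SLE_(8/3) law WITHOUT the hypothesis "supported on simple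
curves". (L): the limit
hypotheses ConfCovLimit and RestrictionOfLimit (verbatim the SAWConfRestriction items, shared) and
TameOfLimit.
Lean: `CorridorMassFiveEighths ∧ ExponentIdentifies ∧ ConfCovLimit ∧ RestrictionOfLimit ∧
TameOfLimit`

## Assembly
Pure logic plus `integral_map` (PROVED sorry-free as `assembly_holds` in the planner's Sketch.lean):
take P from ConfCovLimit with (lim) and (conf); RestrictionOfLimit and TameOfLimit supply (restr)
and (tame) for this P; ExponentIdentifies applied to the target X₀ gives IsSLELaw (8/3) D (P D) =
law of an SLE curve Γ for every D; `MeasureTheory.integral_map` turns TendstoLaw … id (P D) into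
TendstoLaw … Γ preWienerMeasure, and AEMeasurable of γ ↦ γ.curve is `SAW.aemeasurable_curve` — that
is `SAWScalingLimit`. Layer 1 (SpectralPin) feeds X₀ from ranks 2–3 and the two provable-now
supports; it is deliberately kept out of the formal Assembly so that a prover of X₀ by any other
means also closes the route's identification half.

Rationale: WHY THIS LINE. The card counted the conformal tower of the ONE-walk transfer matrix of ℤ² strips at
x_c (validated exact matrices, w ≤ 9): real
simple top, integer gaps 0,1,2,3,3 and ONE even state at level 2 — the character (1−q²)/∏(1−qⁿ) of a
c = 0 module degenerate at level
2, hence h ∈ {0, 5/8} (FriedrichWerner2003 = doi:10.1007/s00220-003-0956-8 §5.1: the restriction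
exponent IS the highest weight at
c = 0 and level-two degeneracy singles out κ = 8/3, h = 5/8; BauerBernard2003;
BelavinPolyakovZamolodchikov1984 =
doi:10.1016/0550-3213(84)90052-X). This route makes that count RIGOROUSLY LOAD-BEARING without any
CFT: expanding the covariant
corridor mass H_m^b (the object of the corridor scaling conjecture of
DyhrGilbertKennedyLawlerPasson2011 = arXiv:1008.4321 eq.
(intro.1)–(intro.2), Z ~ ρ y^(−2b), b = 5/8; LawlerSchrammWerner2004SAW §3.4.2–3.4.5) in q = e^(−πm)
reproduces the whole tower
(levels 0,1,2,3,… with parities e,o,e,oo,… and multiplicities 1,1,1 or 2,2,3,…), and its level-2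
kernel
b(3ρ₃ρ₃′+1) + 2b(b−1)ρ₂²ρ₂′² (ρ₂ = 2cos πy, ρ₃ = 4cos²πy − 1) has 2×2 determinant 16b²(8b−5): "one
state at level two" ⇔ b = 5/8
(checked numerically this session; filed provable-now as KacRankPin + PoissonKernelExpansion). Areas
imported: transfer-matrix
spectral theory and finite-size scaling (Cardy1986OperatorContent =
doi:10.1016/0550-3213(86)90552-3, Derrida1981, Saleur1987 =
doi:10.1088/0305-4470/20/2/031, Jacobsen2009 = doi:10.1007/978-1-4020-9927-4_14 — the KNOWN
methodology, here turned into typed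
lattice statements), Perron–Frobenius/Kreĭn cone positivity for the reality conjecture
(isbn:9780821831717, AlmJanson1990 =
doi:10.1080/15326349908807144 for finite strips), and LSW conformal-restriction theory
(LawlerSchrammWerner2003Restriction, whose
result 2 is PROVED in tree:
Literature.Probability.RandomPlanarGeometry.LawlerSchrammWerner2003_holds). What it does that prior
routes do not: SAWConfRestriction/SAWRestrictionRigidity identify the limit through "carried by
simple curves" (SimpleOfLimit /
axiom (i)); here the exponent is pinned by a lattice COUNT and the curve law is recovered from the
hull law under the weaker
no-retrace tameness, so SimpleOfLimit is not in the assembly; the negatives index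
(stmt-CriticalPhenomena-0772, all-δ tightness) is
avoided by assuming the full limit only through the shared ConfCovLimit.

RANKED CRUXES. (Deciding theorem since rev 2: `closes : CorridorMassFiveEighths → ExponentIdentifies
→ ConfCovLimit → RestrictionOfLimit → TameOfLimit → SAWScalingLimit`, proved by pure logic +
integral_map — ranks 2–3 and the layer-1 supports feed X₀ through SpectralPin and are not hypotheses
of `closes`.) #0 CorridorMassFiveEighths (target) — corridor mass covariance with exponent exactly
5/8: ∃ A : ℕ → ℝ₊ with A(⌊tn⌋)/A(n) → t^(5/4) (t ∈ (0,1]) such that A(n)·Z_n(⌊mn⌋; ⌊yn⌋, ⌊y′n⌋) →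
H_m(y,y′)^(5/8) uniformly on compacts of (m,y,y′) ∈ (0,∞)×(0,1)²; Z_n and H_m inlined (Z_n(ℓ;i,j) =
Σ_s x_c^s #{s-step SAWs of ℤ² from (0,i) to (ℓ,j) inside [0,ℓ]×[1,n]}). Derived from ranks 2–3 by
SpectralPin; consumed by ExponentIdentifies. (why it might fail: b could differ from 5/8 only if
SLE_8/3 is wrong for ℤ²; more likely failure: lattice corrections at the corners/ends not captured
by one sequence A(n) (Kennedy–Lawler boundary effects), or log-corrections at c = 0.)
[arXiv:1008.4321, LawlerSchrammWerner2004SAW, KennedyLawler2013]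
#2 LevelTwoSolitude (crux) — the card's count, typed on partition functions (card count-the-tower r4
+ Conjecture R at K = 9/4): ∃ C₀, Kmax, n₀ such that for every width n ≥ n₀ the end-to-end strip
partition functions admit, for every η > 0, all ℓ ≥ n and bulk rows i,j ∈ [ηn,(1−η)n], a
representation Z_n(ℓ;i,j) = Σ_(k≤K) e_k u_k(i) u_k(j) λ_k^ℓ + R with K ≤ Kmax REAL POSITIVE distinct
rates λ_k all above the line λ₀e^(−9π/4n) (reality of the conformal top), rank-one symmetric
couplings e_k = ±1 (simplicity; signs free — non-unitary), u₀ > 0, |u_k(i)u_k(j)| ≤ C₀u₀(i)u₀(j),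
tail |R| ≤ C₀u₀(i)u₀(j)(λ₀e^(−9π/4n))^ℓ, and EXACTLY ONE rate below λ₀e^(−5π/4n) (one state in the
level-2 window (5/4,9/4): coefficients 1,1,1 of (1−q²)/∏(1−qⁿ)). Windows chosen so that the card's w
= 8, 9 spectra already satisfy them (gaps 0, 0.858/0.874, 1.631/1.676 above the 9/4 line;
2.286/2.376 below). [difficulty: open-problem] (why it might fail: level-3 states converge slowly (3
− 5.8/w): a coupled rate may linger inside (5/4, 9/4) for many widths; complex 'junk' pairs (scaled
gap 3.3–3.5 at w ≤ 8) may stop receding; exact level crossings at isolated widths break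
simplicity/distinctness.) [Summits/CriticalPhenomena/SAWScalingLimit/Ideas/count-the-tower.md,
doi:10.1007/978-1-4020-9927-4_14, doi:10.1016/0550-3213(86)90552-3, doi:10.1080/15326349908807144,
arXiv:hep-th/0607232, isbn:9780821831717]
#3 CorridorCovariance (crux) — LSW mass covariance in corridors with SOME exponent: ∃ b > 0 and A :
ℕ → ℝ₊ regularly varying of index 2b (A(⌊tn⌋)/A(n) → t^(2b)) with A(n)·Z_n(⌊mn⌋; ⌊yn⌋, ⌊y′n⌋) →
H_m(y,y′)^b uniformly on compacts of (0,∞)×(0,1)² (Dyhr–Gilbert–Kennedy–Lawler–Passon's conjecture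
(intro.1)–(intro.2) for the end-to-end corridor, exponent left free: the count, not this crux, fixes
b). [difficulty: open-problem] (why it might fail: it IS conformal covariance of the SAW mass in the
corridor geometry (open since LSW04); a single normalising sequence A(n) presumes lattice boundary
corrections are local and row-independent in the bulk of the end segment.) [arXiv:1008.4321,
LawlerSchrammWerner2004SAW, KennedyLawler2013, doi:10.1007/BF01211100]
#4 ExponentIdentifies (crux) — corridor exponent 5/8 replaces simplicity in LSW's identification:
CorridorMassFiveEighths → for every chordal family P that is the full scaling limit of the critical
δℤ² SAW laws (all Dobrushin domains, all endpoint approximations), is conformally covariant, has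
two-sided restriction, and is tame (a.s. boundary-avoiding, and simple whenever its range is an arc)
— P D is the chordal SLE_(8/3) law for every D. Route: pull back to ℍ; boundary avoidance puts the
filled range in LSW's Ω; dilation invariance + hull multiplicativity ⇒ P_α (Prop. 3.3, in tree); the
corridor pair D = (0,m)×(0,1) ⊋ D′ = (0,m)×(0,1−ε) with marks iy, m+iy′ gives P_D(range ⊆ cl D′) =
(H_D′/H_D)^α by restriction and = lim Z_(n′)/Z_n = (H_D′/H_D)^(5/8) by the exact lattice restriction
identity + X₀ ⇒ α = 5/8 ⇒ hull law = law of the SLE_(8/3) range (Thm 6.1 + uniqueness, in tree) ⇒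
range is a.s. a simple arc ⇒ (no-retrace) P D = SLE_(8/3) law. No use of Cor. 8.6 / Thm. 7.3 /
simplicity. [deps: CorridorMassFiveEighths] [difficulty: L] (why it might fail: Prop 3.3 pull-back
for NON-simple boundary-avoiding curve laws and 'range = simple arc + no retrace ⇒ CurveClass law'
are not in the tree; corridor Dobrushin domains and the null-touching portmanteau step must be
built; endpoint rows sit one column inside D.) [LawlerSchrammWerner2003Restriction,
doi:10.1007/s00220-003-0956-8, LawlerSchrammWerner2004SAW, arXiv:1008.4321]
#5 TameOfLimit (crux) — tameness of any full SAW scaling limit P (weaker than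
SAWConfRestriction.SimpleOfLimit): for every D, P D-a.s. the curve meets ∂D only at the marked
points AND is simple whenever its range is homeomorphic to [0,1] (no retracing of an arc). Intended
lattice mechanism: an ε-retrace forces three strands of one walk through an o(1)-tube of length ε,
whose x_c-cost is governed by the 3-strand/1-strand corridor gap (watermelon h₃ − h₁ = 7/2 > 0) —
again a strip transfer-matrix statement; boundary avoidance from mass covariance near boundary
bumps. [difficulty: XL] (why it might fail: no-retrace along a FRACTAL arc needs a scale-uniform
3-strand penalty per box (RSW-type quasi-multiplicativity for SAW at x_c, not in print); boundary
avoidance needs a boundary 2-leg estimate or mass covariance beyond corridors.)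
[LawlerSchrammWerner2004SAW, KennedyLawler2013, MadrasSlade1993, DuminilCopinKozmaYadin2014]
#6 ConfCovLimit (crux) — verbatim SAWConfRestriction.ConfCovLimit (stmt-CriticalPhenomena-0771,
shared): existence of the full scaling limit of the critical δℤ² SAW as a chordal family P for all
Dobrushin domains and endpoint approximations, and its conformal covariance. Not this route's
mechanism; staffed through the routes that own it; the tower does not produce conformal covariance
(card P4 dropped as untypeable). [difficulty: open-problem] (why it might fail: open since LSW04 p.3
and typed for ALL endpoint approximations incl. rotations on ℤ² where no discrete-holomorphic handle
exists; an approximation-dependent limit refutes the conjunct itself.) [LawlerSchrammWerner2004SAW,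
DuminilCopinSmirnov2012, KennedyLawler2013, Beffara2008Universal]
#9 KacRankPin (support) — for b > 0 the level-2 corridor kernel K₂^b(y,y′) =
b(3(4cos²πy−1)(4cos²πy′−1)+1) + 32b(b−1)cos²πy cos²πy′ factorises as f(y)g(y′) iff b = 5/8
(coefficient matrix [[4b,−12b],[−12b,16b+32b²]] in the basis {1,cos²}, det = 16b²(8b−5); at 5/8, K₂
= (5/2)(1−3cos²πy)(1−3cos²πy′)) — the c = 0 level-2 Kac determinant h²(8h−5) in trigonometric form.
[difficulty: provable-now] [doi:10.1016/0550-3213(84)90052-X, doi:10.1007/s00220-003-0956-8]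
#9 PoissonKernelExpansion (support) — for b > 0 and y, y′ ∈ [η, 1−η]: H_m(y,y′)^b = (2e^(−πm) sin πy
sin πy′)^b (1 + K₁ e^(−πm) + K₂ e^(−2πm)) + O(e^(−(b+3)πm)) uniformly for m ≥ m₀, with K₁ = 8b cos
πy cos πy′ and K₂ as in KacRankPin (from 1/sinh(kπm) = 2q^k(1+q^(2k)+…) and the binomial series;
verified numerically, residual ≈ 0.2 q³). [difficulty: provable-now] [arXiv:1008.4321,
doi:10.1016/0550-3213(86)90552-3]
#9 SpectralPin (support) — glue of layer 1 (kind glue): KacRankPin → PoissonKernelExpansion →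
LevelTwoSolitude → CorridorCovariance → CorridorMassFiveEighths. Proof plan: an exponential-fitting
stability lemma (locally uniform convergence in m of Σ_k a_k^(n) e^(−g_k^(n) t) with bounded K,
separated windows and uniform tail ⇒ termwise convergence), so the continuum level-2 term (2ss′)^b
K₂ q^(b+2) is the limit of the unique window term, whose coefficient kernels are rank one; rank ≤ 1
passes to the limit (2×2 minors); K₂ ≢ 0 (K₂(½,½) = 4b) ⇒ b = 5/8 by KacRankPin; then (C)'s data
witness X₀. [difficulty: M] [doi:10.1080/15326349908807144, arXiv:1008.4321]
#9 RestrictionOfLimit (support) — verbatim SAWConfRestriction.RestrictionOfLimit (shared): any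
chordal full limit P of the SAW laws has the two-sided restriction property (passage of the exact
lattice identity Z_δ(D′)/Z_δ(D) to the limit; portmanteau + null touching). [difficulty: M]
[LawlerSchrammWerner2004SAW, LawlerSchrammWerner2003Restriction]
#9 RealTopPinned (support; rev 3 restatement of RealTop, stmt-7260 → stmt-11321, which was vacuous
as typed — refuter rreview-2de8a21e-0) — Conjecture R of the card (real conformal top, uniform in
the depth) with LevelTwoSolitude's RELATIVE normalisation: for every g, η > 0 there are C₀, Kmax, n₀
such that for all widths n ≥ n₀, Z_n(ℓ;i,j) = Σ_(k≤K) c_k(i,j) λ_k^ℓ + R for ℓ ≥ n and bulk rows i,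
j ∈ [ηn,(1−η)n], with K ≤ Kmax REAL POSITIVE distinct rates in (λ₀e^(−gπ/n), λ₀], the k = 0
coefficient PINNED to the rank-one positive Perron–Frobenius term u₀(i)u₀(j) (u₀ > 0; so λ₀ is the
true growth rate), |c_k(i,j)| ≤ C₀u₀(i)u₀(j) and |R| ≤ C₀u₀(i)u₀(j)(λ₀e^(−gπ/n))^ℓ — no complex pair
and no Jordan block in the conformal part of the non-symmetric, non-integrable strip transfer
spectrum coupled to end insertions, finitely many levels below any depth uniformly in n. g ≤ 9/4 is
contained in LevelTwoSolitude (c_k = e_k u_k(i)u_k(j)); larger g is the card's standalone conjecture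
(mechanism: cone-rank-k positivity / compound matrices, Perron–Frobenius–Kreĭn); K = 0 is
Perron–Frobenius for the primitive strip transfer matrix (Alm–Janson). Not a hypothesis of `closes`.
[difficulty: L] [isbn:9780821831717, doi:10.1080/15326349908807144,
Summits/CriticalPhenomena/SAWScalingLimit/Ideas/count-the-tower.md]

TWO-LAYER PLAN. Foreseen glued splits (none filed now): LevelTwoSolitude ⇐ RealTopNineQuarters (all
coupled rates above the 9/4 line real & simple: cone-rank positivity of T_n or of a compound) →
WindowCount (exactly one rate in (5/4,9/4): interlacing/monotonicity in n) → LevelTwoSolitude;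
TameOfLimit ⇐ ThreeStrandCorridorGap (−(n/π)log(λ^(3 strands)/λ^(1 strand)) ≥ c > 0 uniformly) →
NoRetraceFromGap → TameOfLimit (+ boundary avoidance as third child); ExponentIdentifies ⇐
HullPullbackNonSimple → CorridorAlphaReadout → CurveFromHullNoRetrace; SpectralPin ⇐
ExponentialFitStability → RankPassesToLimit.

KILL CRITERIA. ¬LevelTwoSolitude certified at some n ≥ 12 (a SECOND coupled rate settling in the
level-2 window, a complex pair entering below the 9/4 line and staying, or a Jordan block at level ≤
2) closes the route `refuted:LevelTwoSolitude` — and, given CorridorCovariance, is recorded as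
evidence AGAINST conformal covariance of the ℤ² SAW mass (KacRankPin: b ∉ {0,5/8} would follow).
¬CorridorCovariance (no scaling function at all) refutes LSW's mass-covariance conjecture in
corridors: close, no pivot. ¬KacRankPin cannot happen unless the algebra above is wrong (numerically
checked; det = 16b²(8b−5)). ¬ExponentIdentifies by a tame non-simple restriction-covariant family
with corridor exponent 5/8 would be a new LSW-type exotic: pivot to adding the 2-strand gap
(simplicity) as a crux. ¬TameOfLimit or ¬ConfCovLimit (approximation dependence) refute the conjunct
as typed, for every route. SimpleOfLimit proved elsewhere moots ExponentIdentifies/TameOfLimit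
(LSW03 result 2 is proved in tree) but not ranks 2–3, which stay as the fingerprint.

NOT DECOMPOSED YET. The exponential-fitting stability lemma inside SpectralPin (finite-dimensional
compactness; stated in its docstring, not filed); the corridor Dobrushin domains (polygonDomain of
the rectangle + marks) and the n ↔ n−1, ⌊mn⌋ ↔ ⌈mn⌉−2 bookkeeping between SAW.law on (0,m)×(0,1) at
mesh 1/n and Z_n (absorbed by local uniformity + regular variation); the card's spectral-edge
conjecture E_spec (x*(w) ↓ x_c: the top pair turns complex exactly in the DKY dense phase) — a
μ-free characterisation of x_c, not load-bearing, left as a refuter target; eigenvector-profile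
convergence (u₀ ~ sin^(5/8), u₁/u₀ ~ cos, u₂/u₀ ~ 1−3cos²) which CorridorCovariance implies but
which is not filed separately; the 3-strand corridor gap behind TameOfLimit; hexagonal companions
(there the O(n→0) point is integrable and the tower is Bethe-ansatz territory — card
rigorous-bethe-ansatz-polymer-exponents, not this route).

CHEAPEST FALSIFIER. Rebuild the card's exact T_w(x_c) for w = 8, 9 (≤ 1353 cut-states; hours) and
read the level-2 eigenvector: CorridorCovariance + KacRankPin predict u₂(i)/u₀(i) ∝ 1 − 3cos²(πi/w)
up to O(1/w), i.e. sign changes near rows i ≈ 0.30w and 0.70w and an EVEN profile, and u₁/u₀ ∝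
cos(πi/w) (odd); a level-2 profile with no interior sign change, or two coupled rates in (5/4, 9/4)
at w = 12–14 (sparse Arnoldi on ≤ 10⁵ states, a day of kit compute), retires the line. Not run this
session (kit not in a planner's remit; the ideator's matrices lived in its session folder).

NUMBERS. x_c(ℤ²) = 1/μ ≈ 0.379052 (μ ≈ 2.638158; in tree only 2.6 ≤ μ ≤ 2.7,
LawlerSchrammWerner2004SAW_connectiveConstant_bounds). Card data (w = 4…9): −(w/π)log λ₁ = 0.497,
0.518, 0.533, 0.545, 0.553, 0.561 (→ b = 5/8 = 0.625 with ≈0.57/w); odd gap 0.722…0.874 → 1; even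
gap 1.252…1.676 → 2; next odd 2.173, 2.286, 2.376 and 2.585, 2.633, 2.671 (w = 7,8,9) → 3, 3; first
complex pair at scaled gap 3.3–3.5 (w ≤ 8), real at w = 9. Character (1−q²)/∏(1−qⁿ) = 1 + q + q² +
2q³ + 3q⁴ + 4q⁵ vs generic 1,1,2,3,5. Kernels: K₁ = 8b cos πy cos πy′; K₂ coefficient matrix [[4b,
−12b], [−12b, 16b+32b²]], det 16b²(8b−5); K₂(5/8) = (5/2)(1−3cos²πy)(1−3cos²πy′). SLE side: b = α =
h = 5/8, κ = 8/3, watermelon h_L = L(3L+2)/8 (h₃ − h₁ = 7/2 drives no-retrace). Corridor test of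
arXiv:1008.4321: ρ(x) ∝ cosh(πx/2)^(−5/4) confirmed by simulation (N = 10⁴, 4.96·10⁵ samples).

DEFINITION REQUESTS. To shrink signatures once the ledger queue allows:
`Literature.Probability.RandomPlanarGeometry.SAW.stripPartitionFunction n ℓ i j : ℝ` (the inlined
`let Z`), `Literature.Probability.RandomPlanarGeometry.rectanglePoissonKernel m y y′ : ℝ` (the
inlined `let H`); bib entries DyhrGilbertKennedyLawlerPasson2011, AlmJanson1990,
Cardy1986OperatorContent, Saleur1987, BelavinPolyakovZamolodchikov1984, BloteNienhuis1989,
ChayesChayes1986SAW, PearceRasmussenZuber2006, GantmacherKrein2002 were submitted with `ledger bib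
add` (queued behind the hub backlog at filing; sources above therefore carry doi/arXiv ids as well).

Novelty: Searches (2026-08-15): `lit search --hybrid "transfer matrix self-avoiding walk strip conformal
invariance eigenvalues"` ×3 (searchd unreachable all session: ConnectionResetError — recorded, not
worked around); `lit search … --source crossref "self-avoiding walk in a strip"` (8 rows:
Dyhr–Gilbert–Kennedy–Lawler–Passon 2011 found and READ, arXiv:1008.4321 pp. 3–4, 11–12); `--source
arxiv` (0), `--source openalex` (HTTP 429 budget); `lit galaxy search --star all "self-avoiding walk
transfer matrix conformal"` (0 substring hits); `lit galaxy search --star pdf --mode bm25`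
"conformal spectrum of SAW / O(n=0) transfer matrices on strips vs Virasoro characters" (12:
Jacobsen 2009 ch. 14, Henkel–Karevski LNP, Ginsparg, Jacobsen–Saleur bootstrap …); `lit read
doi:10.1007/s00220-003-0956-8` (Friedrich–Werner p. 9 read); `ledger negatives --problem
CriticalPhenomena` (1); the six Theses files of the sub and the card's own audit
(Pearce–Rasmussen–Zuber hep-th/0607232, von Gehlen–Rittenberg 1986–87, Cardy 1984/86, Saleur 1987,
BKW 1975).
Nearest prior art found: doi:10.1007/s00220-003-0956-8 (Friedrich–Werner 2003: restriction exponent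
= highest weight at c = 0; level-two degeneracy ⇔ κ = 8/3, h = 5/8, derived from the SLE Markov
property); arXiv:1008.4321 (corridor mass covariance Z ~ ρ y^(−2b), b = 5/8, tested by simulation
for walks ACROSS a strip); doi:10.1007/978-1-4020-9927-4_14, doi:10.1088/0305-4470/20/2/031,
Derrida1981, doi:10.1088/0305-4470/22/9/028 (conformal spectra of polym  [refs: 10.1007/s00220-003-0956-8`, 10.1007/s00220-003-0956-8, 10.1007/978-1-4020-9927-4_14, 10.1088/0305-4470/20/2/031, 10.1088/0305-4470/22/9/028, 1008.4321, hep-th/0607232, doi:10.1007/s00220-003-0956-8, doi:10.1007/978-1-4020-9927-4_14, doi:10.1088/0305-4470/20/2/031, doi:10.1088/0305-4470/22/9/028, Derrida1981]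

Barriers (technique_class: transfer-spectrum-count, corridor-restriction-exponent): - technique_class: transfer-spectrum-count, corridor-restriction-exponent
- Literature.Barriers.CriticalPhenomena.SAWNoUnitaryCFT: evaded — no inner product, no unitarity:
the couplings e_k = ±1 are sign-free, K₂ is a real indefinite kernel and only its RANK is used; the
character (1−q²)/∏ enters as a multiplicity pattern of a real spectrum, never as a unitary module
(Gomes triviality untouched).
- Literature.Barriers.CriticalPhenomena.BootstrapLatticeBlindness: evaded by construction — every
filed statement is about ℤ² strip partition functions Z_n(ℓ;i,j) or the SAW laws; CFT supplies only
the target function H_m^b and the window bookkeeping, no axiomatic consistency argument.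
- Literature.Barriers.CriticalPhenomena.GridSAWCountingSharpPComplete: not met — strips of width n
have transfer matrices exponential in n (5, 12, 30, …, 1353 states for w ≤ 9); all statements are
asymptotic in n and no polynomial-time counting in general sub-domains is claimed.
- Literature.Barriers.CriticalPhenomena.EmbeddingModulusUniqueness: honest — the corridor statements
are axis-parallel and embedding-blind (a sheared lattice shows the same tower with a rescaled
width), so they pin the EXPONENT, not rotations; conformal covariance is imported through the
embedding-sensitive shared crux ConfCovLimit; the bet is that identification-by-counting is the part
of LSW's programme a transfer matrix can carry.
- Literature.Barriers.CriticalPhenomena.SupercriticalSAWSpaceFilling: respected — everything is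

Novelty grade: new-combination — ROUTE REVIEW (refuter rreview-2de8a21e-0): KEEP OPEN; new-combination. Layers coherent: Assembly X₀→ExponentIdentifies→ConfCovLimit→RestrictionOfLimit→TameOfLimit→SAWScalingLimit concludes the root Statement abbrev ✓ (candidate by g41-28); SpectralPin (T,C ⟹ X₀) checked on paper: finite real exponen (refuter refuter-rreview-route-AtomisticToContinu-2de8a21e-0, 2026-08-15T14:01:16Z; prior: doi:10.1007/s00220-003-0956-8, arXiv:1008.4321, arXiv:math/0209343, arXiv:math-ph/0604043, arXiv:hep-th/0607232, doi:10.1088/0305-4470/20/2/031, doi:10.1007/978-1-4020-9927-4_14)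

History (route lifecycle, newest last):
- 2026-08-15T17:02:05Z · rev 3: restated RealTop (stmt-CriticalPhenomena-7260) — retriage defect repair (refuter rreview-2de8a21e-0, recorded in the route grade note): rank-9 support RealTop (stmt-CriticalPhenomena-7260, 'Conjecture R') is V (planner-rrepair-CriticalPhenomena-SAWTowerCoun-d4688bb3-g2-0)
- 2026-08-16T02:18:12Z · AUTO-CRUX: 1 conjecture-grade item(s) promoted to crux (RealTopPinned) — refuter vetting / tiering apply (operator:999:1362873)
- 2026-08-16T04:00:57Z · AUTO-CRUX (backfill): CorridorMassFiveEighths — hypotheses of the deciding theorem that nothing in the route derives are cruxes (operator:999:1085951)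

sub-problem: SAWScalingLimit · status: open · opened planner-plancard-CriticalPhenomena-SAWScaling-b5a93b86-0 2026-08-15T12:05:46Z · rev 4 · ledger route-CriticalPhenomena-SAWTowerCount
GENERATED by the gate from the ledger (D-0016/17). Provers cite these decls: `theorem foo : Summit.CriticalPhenomena.SAWScalingLimit.Theses.SAWTowerCount.<Decl> := …` in Summits/CriticalPhenomena/SAWScalingLimit/Theorems/<Name>.lean.
-/

namespace Summit.CriticalPhenomena.SAWScalingLimit.Theses.SAWTowerCount

open scoped BigOperators Topology Manifold Classical MeasureTheory ProbabilityTheory Matrix InnerProductSpace ComplexConjugate ContinuousMap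
open Filter Set Function TopologicalSpace MeasureTheory

attribute [summit_statement] _root_.SAWScalingLimit

/-- item stmt-CriticalPhenomena-7252 · crux (kind.auto-crux: conjecture-grade) · rank 0 · open · by planner
why it might fail: b could differ from 5/8 only if SLE_8/3 is wrong for ℤ²; more likely failure: lattice corrections at the corners/ends not captured by one sequence A(n) (Kennedy–Lawler boundary effects), or log-corrections at c = 0.
sources: arXiv:1008.4321, LawlerSchrammWerner2004SAW, KennedyLawler2013
[target] corridor mass covariance with exponent exactly 5/8: ∃ A : ℕ → ℝ₊ with A(⌊tn⌋)/A(n) →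
t^(5/4) (t ∈ (0,1]) such that A(n)·Z_n(⌊mn⌋; ⌊yn⌋, ⌊y′n⌋) → H_m(y,y′)^(5/8) uniformly on compacts of
(m,y,y′) ∈ (0,∞)×(0,1)²; Z_n and H_m inlined (Z_n(ℓ;i,j) = Σ_s x_c^s #{s-step SAWs of ℤ² from (0,i)
to (ℓ,j) inside [0,ℓ]×[1,n]}). Derived from ranks 2–3 by SpectralPin; consumed by
ExponentIdentifies. -/
@[route_item "route-CriticalPhenomena-SAWTowerCount", crux]
def CorridorMassFiveEighths : Prop :=
  let Z : ℕ → ℕ → ℤ → ℤ → ℝ := fun n ℓ i j => ∑ s ∈ Finset.range ((ℓ + 1) * n + 1), Literature.Probability.RandomPlanarGeometry.SAW.criticalFugacity ^ s * ((((Literature.Probability.LatticeModels.zdGraph 2).finsetWalkLength s (![0, i] : Literature.Probability.LatticeModels.Site 2) ![(ℓ : ℤ), j]).filter (fun p => p.IsPath ∧ ∀ v ∈ p.support, 0 ≤ v 0 ∧ v 0 ≤ (ℓ : ℤ) ∧ 1 ≤ v 1 ∧ v 1 ≤ (n : ℤ))).card : ℝ); let H : ℝ → ℝ → ℝ → ℝ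 := fun m y y' => ∑' k : ℕ, ((k : ℝ) + 1) * Real.sin (((k : ℝ) + 1) * Real.pi * y) * Real.sin (((k : ℝ) + 1) * Real.pi * y') / Real.sinh (((k : ℝ) + 1) * Real.pi * m); ∃ A : ℕ → ℝ, (∀ n, 0 < A n) ∧ (∀ t : ℝ, 0 < t → t ≤ 1 → Filter.Tendsto (fun n : ℕ => A ⌊t * n⌋₊ / A n) Filter.atTop (nhds (t ^ (5 / 4 : ℝ)))) ∧ ∀ ε m₀ m₁ η : ℝ, 0 < ε → 0 < m₀ → m₀ ≤ m₁ → 0 < η → ∃ N : ℕ, ∀ n : ℕ, N ≤ n → ∀ m y y' : ℝ, m₀ ≤ m → m ≤ m₁ → η ≤ y → y ≤ 1 - η → η ≤ y' → y' ≤ 1 - η → |A n * Z n ⌊m * n⌋₊ ⌊y * n⌋ ⌊y' * n⌋ - H m y y' ^ (5 / 8 : ℝ)| ≤ ε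

/-- item stmt-CriticalPhenomena-7253 · crux · rank 2 · open · by planner
why it might fail: level-3 states converge slowly (3 − 5.8/w): a coupled rate may linger inside (5/4, 9/4) for many widths; complex 'junk' pairs (scaled gap 3.3–3.5 at w ≤ 8) may stop receding; exact level crossings at isolated widths break simplicity/distinctness.
sources: Summits/CriticalPhenomena/SAWScalingLimit/Ideas/count-the-tower.md, doi:10.1007/978-1-4020-9927-4_14, doi:10.1016/0550-3213(86)90552-3, doi:10.1080/15326349908807144, arXiv:hep-th/0607232, isbn:9780821831717
[crux] the card's count, typed on partition functions (card count-the-tower r4 + Conjecture R at K =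
9/4): ∃ C₀, Kmax, n₀ such that for every width n ≥ n₀ the end-to-end strip partition functions
admit, for every η > 0, all ℓ ≥ n and bulk rows i,j ∈ [ηn,(1−η)n], a representation Z_n(ℓ;i,j) =
Σ_(k≤K) e_k u_k(i) u_k(j) λ_k^ℓ + R with K ≤ Kmax REAL POSITIVE distinct rates λ_k all above the
line λ₀e^(−9π/4n) (reality of the conformal top), rank-one symmetric couplings e_k = ±1 (simplicity;
signs free — non-unitary), u₀ > 0, |u_k(i)u_k(j)| ≤ C₀u₀(i)u₀(j), tail |R| ≤
C₀u₀(i)u₀(j)(λ₀e^(−9π/4n))^ℓ, and EXACTLY ONE rate below λ₀e^(−5π/4n) (one state in the level-2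
window (5/4,9/4): coefficients 1,1,1 of (1−q²)/∏(1−qⁿ)). Windows chosen so that the card's w = 8, 9
spectra already satisfy them (gaps 0, 0.858/0.874, 1.631/1.676 above the 9/4 line; 2.286/2.376
below). [difficulty: open-problem] -/
@[route_item "route-CriticalPhenomena-SAWTowerCount"]
def LevelTwoSolitude : Prop :=
  let Z : ℕ → ℕ → ℤ → ℤ → ℝ := fun n ℓ i j => ∑ s ∈ Finset.range ((ℓ + 1) * n + 1), Literature.Probability.RandomPlanarGeometry.SAW.criticalFugacity ^ s * ((((Literature.Probability.LatticeModels.zdGraph 2).finsetWalkLength s (![0, i] : Literature.Probability.LatticeModels.Site 2) ![(ℓ : ℤ), j]).filter (fun p => p.IsPath ∧ ∀ v ∈ p.support, 0 ≤ v 0 ∧ v 0 ≤ (ℓ : ℤ) ∧ 1 ≤ v 1 ∧ v 1 ≤ (n : ℤ))).card : ℝ); ∀ η : ℝ, 0 < η → ∃ (C₀ : ℝ) (Kmax n₀ : ℕ), ∀ n : ℕ, n₀ ≤ n → ∃ (K : ℕ) (lam e : ℕ → ℝ) (u : ℕ → ℤ → ℝ), K ≤ Kmax ∧ e 0 = 1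 ∧ (∀ k ≤ K, 0 < lam k ∧ e k ^ 2 = 1 ∧ lam k ≤ lam 0 ∧ lam 0 * Real.exp (-(9 / 4) * Real.pi / n) < lam k) ∧ (∀ k ≤ K, ∀ k' ≤ K, k ≠ k' → lam k ≠ lam k') ∧ (∃! k : ℕ, k ≤ K ∧ lam k < lam 0 * Real.exp (-(5 / 4) * Real.pi / n)) ∧ ∀ i j : ℤ, η * n ≤ i → i ≤ (1 - η) * n → η * n ≤ j → j ≤ (1 - η) * n → 0 < u 0 i ∧ (∀ k ≤ K, |u k i * u k j| ≤ C₀ * (u 0 i * u 0 j)) ∧ ∀ ℓ : ℕ, n ≤ ℓ → |Z n ℓ i j - ∑ k ∈ Finset.range (K + 1), e k * u k i * u k j * lam k ^ ℓ| ≤ C₀ * (u 0 i * u 0 j) * (lam 0 * Real.exp (-(9 / 4) * Real.pi / n)) ^ ℓ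

/-- item stmt-CriticalPhenomena-7254 · crux · rank 3 · open · by planner
why it might fail: it IS conformal covariance of the SAW mass in the corridor geometry (open since LSW04); a single normalising sequence A(n) presumes lattice boundary corrections are local and row-independent in the bulk of the end segment.
sources: arXiv:1008.4321, LawlerSchrammWerner2004SAW, KennedyLawler2013, doi:10.1007/BF01211100
[crux] LSW mass covariance in corridors with SOME exponent: ∃ b > 0 and A : ℕ → ℝ₊ regularly varying
of index 2b (A(⌊tn⌋)/A(n) → t^(2b)) with A(n)·Z_n(⌊mn⌋; ⌊yn⌋, ⌊y′n⌋) → H_m(y,y′)^b uniformly on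
compacts of (0,∞)×(0,1)² (Dyhr–Gilbert–Kennedy–Lawler–Passon's conjecture (intro.1)–(intro.2) for
the end-to-end corridor, exponent left free: the count, not this crux, fixes b). [difficulty:
open-problem] -/
@[route_item "route-CriticalPhenomena-SAWTowerCount", crux]
def CorridorCovariance : Prop :=
  let Z : ℕ → ℕ → ℤ → ℤ → ℝ := fun n ℓ i j => ∑ s ∈ Finset.range ((ℓ + 1) * n + 1), Literature.Probability.RandomPlanarGeometry.SAW.criticalFugacity ^ s * ((((Literature.Probability.LatticeModels.zdGraph 2).finsetWalkLength s (![0, i] : Literature.Probability.LatticeModels.Site 2) ![(ℓ : ℤ), j]).filter (fun p => p.IsPath ∧ ∀ v ∈ p.support, 0 ≤ v 0 ∧ v 0 ≤ (ℓ : ℤ) ∧ 1 ≤ v 1 ∧ v 1 ≤ (n : ℤ))).card : ℝ); let H : ℝ → ℝ → ℝ → ℝ := fun m y y' => ∑' k : ℕ, ((k : ℝ) + 1) * Real.sin (((k : ℝ) + 1) * Real.pi * y) * Real.sin (((k : ℝ) + 1) * Real.pi * y') / Real.sinh (((k : ℝ) + 1) * Real.pi * m); ∃ b : ℝ, 0 <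 b ∧ ∃ A : ℕ → ℝ, (∀ n, 0 < A n) ∧ (∀ t : ℝ, 0 < t → t ≤ 1 → Filter.Tendsto (fun n : ℕ => A ⌊t * n⌋₊ / A n) Filter.atTop (nhds (t ^ (2 * b)))) ∧ ∀ ε m₀ m₁ η : ℝ, 0 < ε → 0 < m₀ → m₀ ≤ m₁ → 0 < η → ∃ N : ℕ, ∀ n : ℕ, N ≤ n → ∀ m y y' : ℝ, m₀ ≤ m → m ≤ m₁ → η ≤ y → y ≤ 1 - η → η ≤ y' → y' ≤ 1 - η → |A n * Z n ⌊m * n⌋₊ ⌊y * n⌋ ⌊y' * n⌋ - H m y y' ^ b| ≤ ε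

/-- item stmt-CriticalPhenomena-7255 · crux · rank 4 · open · by planner
why it might fail: Prop 3.3 pull-back for NON-simple boundary-avoiding curve laws and 'range = simple arc + no retrace ⇒ CurveClass law' are not in the tree; corridor Dobrushin domains and the null-touching portmanteau step must be built; endpoint rows sit one column inside D.
sources: LawlerSchrammWerner2003Restriction, doi:10.1007/s00220-003-0956-8, LawlerSchrammWerner2004SAW, arXiv:1008.4321
[crux] corridor exponent 5/8 replaces simplicity in LSW's identification: CorridorMassFiveEighths →
for every chordal family P that is the full scaling limit of the critical δℤ² SAW laws (all
Dobrushin domains, all endpoint approximations), is conformally covariant, has two-sided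
restriction, and is tame (a.s. boundary-avoiding, and simple whenever its range is an arc) — P D is
the chordal SLE_(8/3) law for every D. Route: pull back to ℍ; boundary avoidance puts the filled
range in LSW's Ω; dilation invariance + hull multiplicativity ⇒ P_α (Prop. 3.3, in tree); the
corridor pair D = (0,m)×(0,1) ⊋ D′ = (0,m)×(0,1−ε) with marks iy, m+iy′ gives P_D(range ⊆ cl D′) =
(H_D′/H_D)^α by restriction and = lim Z_(n′)/Z_n = (H_D′/H_D)^(5/8) by the exact lattice restriction
identity + X₀ ⇒ α = 5/8 ⇒ hull law = law of the SLE_(8/3) range (Thm 6.1 + uniqueness, in tree) ⇒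
range is a.s. a simple arc ⇒ (no-retrace) P D = SLE_(8/3) law. No use of Cor. 8.6 / Thm. 7.3 /
simplicity. [deps: CorridorMassFiveEighths] [difficulty: L] -/
@[route_item "route-CriticalPhenomena-SAWTowerCount", crux]
def ExponentIdentifies : Prop :=
  CorridorMassFiveEighths → ∀ P : Literature.Probability.RandomPlanarGeometry.ChordalFamily, P.IsChordal → (∀ (D : Literature.Probability.RandomPlanarGeometry.DobrushinDomain) (a b : ℝ → Literature.Probability.LatticeModels.Site 2), Literature.Probability.RandomPlanarGeometry.SAW.IsEndpointApprox D a b → Literature.Probability.RandomPlanarGeometry.TendstoLaw (fun δ (γ : Literature.Probability.RandomPlanarGeometry.SAW.DomainSAW D.carrier δ (a δ) (b δ)) => γ.curve) (fun δ => Literature.Probability.RandomPlanarGeometry.SAW.law D.carrier δ (a δ) (b δ)) id (P D)) → (∀ (D D' : Literature.Probability.RandomPlanarGeometry.DobrushinDomain) (g : Literature.Probability.RandomPlanarGeometry.ConformalEquiv D.carrier D'.carrier) (Φ : C(ℂ, ℂ)), g.HasBoundaryValue (D.pt 0) (D'.pt 0) → g.HasBoundaryValue (D.pt 1) (D'.pt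 1) → Set.EqOn Φ g D.carrier → P D' = (P D).map (Literature.Probability.RandomPlanarGeometry.CurveClass.map Φ)) → (∀ (D D' : Literature.Probability.RandomPlanarGeometry.DobrushinDomain), D'.carrier ⊆ D.carrier → D'.pt 0 = D.pt 0 → D'.pt 1 = D.pt 1 → ∀ T : Set (Literature.Probability.RandomPlanarGeometry.CurveClass ℂ), MeasurableSet T → P D' T * P D (Literature.Probability.RandomPlanarGeometry.CurveClass.rangeSubset (closure D'.carrier)) = P D (T ∩ Literature.Probability.RandomPlanarGeometry.CurveClass.rangeSubset (closure D'.carrier))) → (∀ D : Literature.Probability.RandomPlanarGeometry.DobrushinDomain, ∀ᵐ γ ∂(P D), γ.range ∩ frontier D.carrier ⊆ {D.pt 0, D.pt 1} ∧ (Nonempty (Set.Icc (0 : ℝ) 1 ≃ₜ γ.range) → γ ∈ Literature.Probability.RandomPlanarGeometry.CurveClass.simple)) → ∀ D : Literature.Probability.RandomPlanarGeometry.DobrushinDomain, Literature.Probability.RandomPlanarGeometry.IsSLELaw ((8 : NNReal) / 3) D (P D)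

/-- item stmt-CriticalPhenomena-7256 · crux · rank 5 · open · by planner
why it might fail: no-retrace along a FRACTAL arc needs a scale-uniform 3-strand penalty per box (RSW-type quasi-multiplicativity for SAW at x_c, not in print); boundary avoidance needs a boundary 2-leg estimate or mass covariance beyond corridors.
sources: LawlerSchrammWerner2004SAW, KennedyLawler2013, MadrasSlade1993, DuminilCopinKozmaYadin2014
[crux] tameness of any full SAW scaling limit P (weaker than SAWConfRestriction.SimpleOfLimit): for
every D, P D-a.s. the curve meets ∂D only at the marked points AND is simple whenever its range is
homeomorphic to [0,1] (no retracing of an arc). Intended lattice mechanism: an ε-retrace forces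
three strands of one walk through an o(1)-tube of length ε, whose x_c-cost is governed by the
3-strand/1-strand corridor gap (watermelon h₃ − h₁ = 7/2 > 0) — again a strip transfer-matrix
statement; boundary avoidance from mass covariance near boundary bumps. [difficulty: XL] -/
@[route_item "route-CriticalPhenomena-SAWTowerCount", crux]
def TameOfLimit : Prop :=
  ∀ P : Literature.Probability.RandomPlanarGeometry.ChordalFamily, P.IsChordal → (∀ (D : Literature.Probability.RandomPlanarGeometry.DobrushinDomain) (a b : ℝ → Literature.Probability.LatticeModels.Site 2), Literature.Probability.RandomPlanarGeometry.SAW.IsEndpointApprox D a b → Literature.Probability.RandomPlanarGeometry.TendstoLaw (fun δ (γ : Literature.Probability.RandomPlanarGeometry.SAW.DomainSAW D.carrier δ (a δ) (b δ)) => γ.curve) (fun δ => Literature.Probability.RandomPlanarGeometry.SAW.law D.carrier δ (a δ) (b δ)) id (P D)) → ∀ D : Literature.Probability.RandomPlanarGeometry.DobrushinDomain, ∀ᵐ γ ∂(P D), γ.range ∩ frontier D.carrier ⊆ {D.pt 0, D.pt 1} ∧ (Nonempty (Set.Icc (0 : ℝ) 1 ≃ₜ γ.range) → γ ∈ Lit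erature.Probability.RandomPlanarGeometry.CurveClass.simple)

/-- item stmt-CriticalPhenomena-0771 · crux · rank 6 · open · by planner
why it might fail: open since LSW04 p.3 and typed for ALL endpoint approximations incl. rotations on ℤ² where no discrete-holomorphic handle exists; an approximation-dependent limit refutes the conjunct itself.
sources: LawlerSchrammWerner2004SAW, DuminilCopinSmirnov2012, KennedyLawler2013, Beffara2008Universal
[crux] r2 (hardest): existence and conformal covariance of the SAW scaling limit — ∃ chordal family
P with (lim) the critical square-lattice SAW law in (Ω_δ; a_δ, b_δ) converges weakly to P D for
every Dobrushin domain and every endpoint approximation, and (conf) P D' = Φ_*(P D) for every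
conformal g : D → D' with boundary values a↦a', b↦b' (Φ any continuous extension of g from D). LSW04
arXiv:math/0204277 p.3: both existence and conformal covariance are open; DuminilCopinSmirnov2012
Conj. 1. -/
@[route_item "route-CriticalPhenomena-SAWTowerCount", crux]
def ConfCovLimit : Prop :=
  ∃ P : Literature.Probability.RandomPlanarGeometry.ChordalFamily, P.IsChordal ∧ (∀ (D : Literature.Probability.RandomPlanarGeometry.DobrushinDomain) (a b : ℝ → Literature.Probability.LatticeModels.Site 2), Literature.Probability.RandomPlanarGeometry.SAW.IsEndpointApprox D a b → Literature.Probability.RandomPlanarGeometry.TendstoLaw (fun δ (γ : Literature.Probability.RandomPlanarGeometry.SAW.DomainSAW D.carrier δ (a δ) (b δ)) => γ.curve) (fun δ => Literature.Probability.RandomPlanarGeometry.SAW.law D.carrier δ (a δ) (b δ)) id (P D)) ∧ (∀ (D D' : Literature.Probability.RandomPlanarGeometry.DobrushinDomain) (g : Literature.Probability.RandomPlanarGeometry.ConformalEquiv D.carrier D'.carrier) (Φ : C(ℂ, ℂ)), g.HasBoundaryValue (D.pt 0) (D'.pt 0) → g.HasBoundaryValue (D.pt 1) (D'.pt 1) →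 Set.EqOn Φ g D.carrier → P D' = (P D).map (Literature.Probability.RandomPlanarGeometry.CurveClass.map Φ))

/-- item stmt-CriticalPhenomena-11321 · crux (kind.auto-crux: conjecture-grade) · rank 9 · open · by planner
why it might fail: auto-crux — conjecture-grade statement (docstring avows it ('Conjecture')); it is open, so it may simply be false
sources: isbn:9780821831717, doi:10.1080/15326349908807144, Summits/CriticalPhenomena/SAWScalingLimit/Ideas/count-the-tower.md
[support] Conjecture R of the card (real conformal top, uniform in the depth), RESTATED
non-vacuously with stmt-CriticalPhenomena-7253's relative normalisation (refuter rreview-2de8a21e-0: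
the rank-9 original was satisfiable by K = 0, c = 0, an inflated λ₀ and an absolute C): for every
depth g > 0 and margin η > 0 there are C₀, Kmax, n₀ such that for every width n ≥ n₀, Z_n(ℓ;i,j) =
Σ_(k≤K) c_k(i,j) λ_k^ℓ + R for all ℓ ≥ n and bulk rows i,j ∈ [ηn,(1−η)n], with K ≤ Kmax REAL
POSITIVE DISTINCT rates λ_k in the window (λ₀e^(−gπ/n), λ₀], the k = 0 coefficient PINNED to the
rank-one positive Perron–Frobenius term c₀(i,j) = u₀(i)u₀(j), u₀ > 0 (so λ₀ is the true growth rate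
of Z_n(·;i,j)), all coefficients |c_k(i,j)| ≤ C₀u₀(i)u₀(j) and the tail |R| ≤
C₀u₀(i)u₀(j)(λ₀e^(−gπ/n))^ℓ RELATIVE to it — no complex pair and no Jordan block in the conformal
part of the non-symmetric, non-integrable strip transfer spectrum coupled to end insertions,
finitely many levels below any depth uniformly in n. g ≤ 9/4 is contained in LevelTwoSolitude (take
c_k = e_k u_k(i)u_k(j)); larger g is the card's standalone conjecture (mechanism: cone-rank-k
positivity / compound matrices, Perron–Frobenius–Kreĭn; K = 0 -/
@[route_item "route-CriticalPhenomena-SAWTowerCount"]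
def RealTopPinned : Prop :=
  let Z : ℕ → ℕ → ℤ → ℤ → ℝ := fun n ℓ i j => ∑ s ∈ Finset.range ((ℓ + 1) * n + 1), Literature.Probability.RandomPlanarGeometry.SAW.criticalFugacity ^ s * ((((Literature.Probability.LatticeModels.zdGraph 2).finsetWalkLength s (![0, i] : Literature.Probability.LatticeModels.Site 2) ![(ℓ : ℤ), j]).filter (fun p => p.IsPath ∧ ∀ v ∈ p.support, 0 ≤ v 0 ∧ v 0 ≤ (ℓ : ℤ) ∧ 1 ≤ v 1 ∧ v 1 ≤ (n : ℤ))).card : ℝ); ∀ g η : ℝ, 0 < g → 0 < η → ∃ (C₀ : ℝ) (Kmax n₀ : ℕ), ∀ n : ℕ, n₀ ≤ n → ∃ (K : ℕ) (lam : ℕ → ℝ) (c : ℕ → ℤ → ℤ → ℝ) (u₀ : ℤ → ℝ), K ≤ Kmax ∧ (∀ k ≤ K, 0 < lam k ∧ lam k ≤ lam 0 ∧ lam 0 * Real.exp (-g * Real.pi / n) < lam k) ∧ (∀ k ≤ K, ∀ k' ≤ K, k ≠ k' → lam k ≠ lam k') ∧ ∀ i j : ℤ, η * n ≤ i → i ≤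 (1 - η) * n → η * n ≤ j → j ≤ (1 - η) * n → 0 < u₀ i ∧ c 0 i j = u₀ i * u₀ j ∧ (∀ k ≤ K, |c k i j| ≤ C₀ * (u₀ i * u₀ j)) ∧ ∀ ℓ : ℕ, n ≤ ℓ → |Z n ℓ i j - ∑ k ∈ Finset.range (K + 1), c k i j * lam k ^ ℓ| ≤ C₀ * (u₀ i * u₀ j) * (lam 0 * Real.exp (-g * Real.pi / n)) ^ ℓ

/-- item stmt-CriticalPhenomena-0773 · support · rank 9 · open · by planner
sources: LawlerSchrammWerner2004SAW, LawlerSchrammWerner2003Restriction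
[crux] r4: every chordal family P that is the weak limit (lim) of the critical SAW laws satisfies
the restriction property: for Jordan D' ⊆ D with the same marked points and measurable T, P D'(T) ·
P D(range ⊆ closure D') = P D(T ∩ {range ⊆ closure D'}). At lattice level this is an identity (LSW04
arXiv:math/0204277 p.24); the content is the passage to the limit (portmanteau on a closed event,
boundary-touching has P D-measure 0). -/
@[route_item "route-CriticalPhenomena-SAWTowerCount", crux]
def RestrictionOfLimit : Prop :=
  ∀ P : Literature.Probability.RandomPlanarGeometry.ChordalFamily, P.IsChordal → (∀ (D : Literature.Probability.RandomPlanarGeometry.DobrushinDomain) (a b : ℝ → Literature.Probability.LatticeModels.Site 2), Literature.Probability.RandomPlanarGeometry.SAW.IsEndpointApprox D a b → Literature.Probability.RandomPlanarGeometry.TendstoLaw (fun δ (γ : Literature.Probability.RandomPlanarGeometry.SAW.DomainSAW D.carrier δ (a δ) (b δ)) => γ.curve) (fun δ => Literature.Probability.RandomPlanarGeometry.SAW.law D.carrier δ (a δ) (b δ)) id (P D)) → ∀ (D D' : Literature.Probability.RandomPlanarGeometry.DobrushinDomain), D'.carrier ⊆ D.carrier → D'.pt 0 = D.pt 0 → D'.pt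 1 = D.pt 1 → ∀ T : Set (Literature.Probability.RandomPlanarGeometry.CurveClass ℂ), MeasurableSet T → P D' T * P D (Literature.Probability.RandomPlanarGeometry.CurveClass.rangeSubset (closure D'.carrier)) = P D (T ∩ Literature.Probability.RandomPlanarGeometry.CurveClass.rangeSubset (closure D'.carrier))

/-- item stmt-CriticalPhenomena-7257 · support · rank 9 · closed · proved by Summit.CriticalPhenomena.SAWScalingLimit.Theorems.kacRankPin_proof @ 5650e60faa7f (prover) · by planner
sources: doi:10.1016/0550-3213(84)90052-X, doi:10.1007/s00220-003-0956-8
[support] for b > 0 the level-2 corridor kernel K₂^b(y,y′) = b(3(4cos²πy−1)(4cos²πy′−1)+1) +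
32b(b−1)cos²πy cos²πy′ factorises as f(y)g(y′) iff b = 5/8 (coefficient matrix
[[4b,−12b],[−12b,16b+32b²]] in the basis {1,cos²}, det = 16b²(8b−5); at 5/8, K₂ =
(5/2)(1−3cos²πy)(1−3cos²πy′)) — the c = 0 level-2 Kac determinant h²(8h−5) in trigonometric form.
[difficulty: provable-now] -/
@[route_item "route-CriticalPhenomena-SAWTowerCount", crux]
def KacRankPin : Prop :=
  ∀ b : ℝ, 0 < b → let K₂ : ℝ → ℝ → ℝ := fun y y' => b * (3 * (4 * Real.cos (Real.pi * y) ^ 2 - 1) * (4 * Real.cos (Real.pi * y') ^ 2 - 1) + 1) + 32 * b * (b - 1) * Real.cos (Real.pi * y) ^ 2 * Real.cos (Real.pi * y') ^ 2; ((∃ f g : ℝ → ℝ, ∀ y y' : ℝ, K₂ y y' = f y * g y') ↔ b = 5 / 8)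

/-- item stmt-CriticalPhenomena-7258 · support · rank 9 · closed · proved by Summit.CriticalPhenomena.SAWScalingLimit.Theorems.poissonKernelExpansion_proof (prover) · by planner
sources: arXiv:1008.4321, doi:10.1016/0550-3213(86)90552-3
[support] for b > 0 and y, y′ ∈ [η, 1−η]: H_m(y,y′)^b = (2e^(−πm) sin πy sin πy′)^b (1 + K₁ e^(−πm)
+ K₂ e^(−2πm)) + O(e^(−(b+3)πm)) uniformly for m ≥ m₀, with K₁ = 8b cos πy cos πy′ and K₂ as in
KacRankPin (from 1/sinh(kπm) = 2q^k(1+q^(2k)+…) and the binomial series; verified numerically,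
residual ≈ 0.2 q³). [difficulty: provable-now] -/
@[route_item "route-CriticalPhenomena-SAWTowerCount", crux]
def PoissonKernelExpansion : Prop :=
  ∀ b η : ℝ, 0 < b → 0 < η → η < 1 / 2 → let H : ℝ → ℝ → ℝ → ℝ := fun m y y' => ∑' k : ℕ, ((k : ℝ) + 1) * Real.sin (((k : ℝ) + 1) * Real.pi * y) * Real.sin (((k : ℝ) + 1) * Real.pi * y') / Real.sinh (((k : ℝ) + 1) * Real.pi * m); let K₁ : ℝ → ℝ → ℝ := fun y y' => 8 * b * Real.cos (Real.pi * y) * Real.cos (Real.pi * y'); let K₂ : ℝ → ℝ → ℝ := fun y y' => b * (3 * (4 * Real.cos (Real.pi * y) ^ 2 - 1) * (4 * Real.cos (Real.pi * y') ^ 2 - 1) + 1) + 32 * b * (b - 1) * Real.cos (Real.pi * y) ^ 2 * Real.cos (Real.pi * y') ^ 2; ∃ C m₀ : ℝ, ∀ m y y' : ℝ, m₀ ≤ m → η ≤ y → y ≤ 1 - η → η ≤ y' → y' ≤ 1 - η → |H m y y' ^ b - (2 * Real.exp (-Real.pi * m) * Real.sin (Real.pi * y) * Real.sin (Real.pi *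 y')) ^ b * (1 + K₁ y y' * Real.exp (-Real.pi * m) + K₂ y y' * Real.exp (-2 * Real.pi * m))| ≤ C * Real.exp (-(b + 3) * Real.pi * m)

/-- item stmt-CriticalPhenomena-7259 · support · rank 9 · open · by planner
sources: doi:10.1080/15326349908807144, arXiv:1008.4321
[support] glue of layer 1 (kind glue): KacRankPin → PoissonKernelExpansion → LevelTwoSolitude →
CorridorCovariance → CorridorMassFiveEighths. Proof plan: an exponential-fitting stability lemma
(locally uniform convergence in m of Σ_k a_k^(n) e^(−g_k^(n) t) with bounded K, separated windows
and uniform tail ⇒ termwise convergence), so the continuum level-2 term (2ss′)^b K₂ q^(b+2) is the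
limit of the unique window term, whose coefficient kernels are rank one; rank ≤ 1 passes to the
limit (2×2 minors); K₂ ≢ 0 (K₂(½,½) = 4b) ⇒ b = 5/8 by KacRankPin; then (C)'s data witness X₀.
[difficulty: M] -/
@[route_item "route-CriticalPhenomena-SAWTowerCount"]
def SpectralPin : Prop :=
  KacRankPin → PoissonKernelExpansion → LevelTwoSolitude → CorridorCovariance → CorridorMassFiveEighths

/-- item stmt-CriticalPhenomena-7261 · assembly · rank 1 · closed · proved by Summit.CriticalPhenomena.SAWScalingLimit.Theorems.sawTowerCount_assembly_proof @ cdab78711d30 (prover) · by planner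
sources: LawlerSchrammWerner2003Restriction, LawlerSchrammWerner2004SAW
[assembly] CorridorMassFiveEighths → ExponentIdentifies → ConfCovLimit → RestrictionOfLimit →
TameOfLimit → SAWScalingLimit. -/
@[route_item "route-CriticalPhenomena-SAWTowerCount"]
def Assembly : Prop :=
  CorridorMassFiveEighths → ExponentIdentifies → ConfCovLimit → RestrictionOfLimit → TameOfLimit → SAWScalingLimit

-- records of items no longer active in this route (dropped / restated):
-- earlier RealTop (stmt-CriticalPhenomena-7260, replaced 2026-08-15T17:02:05Z -> stmt-CriticalPhenomena-11321): retired by None — let Z : ℕ → ℕ → ℤ → ℤ → ℝ := fun n ℓ i j => ∑ s ∈ Finset.range ((ℓ + 1) * n + 1), Literature.Probability.RandomPlanarGeometry.SAW.criticalFugacity ^ s * ((((Literature.Probability.LatticeModels.zdGraph 2).finsetWalkLength s (![0, i] : Literature.Probability.LatticeModels.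

/-! D-0027 §2.1 — DECIDING THEOREM (planner-authored via `route open/edit --closes-file`; by planner-rrepair-CriticalPhenomena-SAWTowerCoun-d4688bb3-g2-0 2026-08-15T16:58:51Z):
its hypotheses are this route's items and its conclusion the sub-problem Statement (glue_lint), and it elaborates with this file. -/

@[closes "route-CriticalPhenomena-SAWTowerCount"] theorem closes (h_CorridorMassFiveEighths : CorridorMassFiveEighths)
    (h_ExponentIdentifies : ExponentIdentifies) (h_ConfCovLimit : ConfCovLimit)
    (h_RestrictionOfLimit : RestrictionOfLimit) (h_TameOfLimit : TameOfLimit) :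
    _root_.SAWScalingLimit := by
  intro D a b hab
  obtain ⟨P, hP, hlim, hconf⟩ := h_ConfCovLimit
  have hrestr := h_RestrictionOfLimit P hP hlim
  have htame := h_TameOfLimit P hP hlim
  obtain ⟨Γ, hΓ, hPD⟩ :=
    h_ExponentIdentifies h_CorridorMassFiveEighths P hP hlim hconf hrestr htame D
  refine ⟨Γ, hΓ, Filter.Eventually.of_forall fun δ =>
    Literature.Probability.RandomPlanarGeometry.SAW.aemeasurable_curve _ _ _ _, ?_⟩
  intro f
  have h := hlim D a b hab f
  simp only [id] at h
  rw [hPD, MeasureTheory.integral_map hΓ.aemeasurable f.continuous.aestronglyMeasurable] at h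
  exact h

end Summit.CriticalPhenomena.SAWScalingLimit.Theses.SAWTowerCount
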